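import Literature.MathematicalPhysics.QuantumLattice.ProjectedBCSState
import Literature.MathematicalPhysics.QuantumLattice.FermionRelabelling
import HarnessLib

/-!
# The projected `d`-wave BCS state: real gauge and reflection-forced nodes

Trunk T-QLATTICE (`Literature/MathematicalPhysics/QuantumLattice`); definition request
`defn-projectedBCSState-2` (route HubbardSuperconductivity/FixedNodeShadow, items
`stmt-HubbardSuperconductivity-2105` (FnTrialState) and `-2103` (FnAnchorOrder)), a follow-up to
`ProjectedBCSState.lean` (`projectedBCSState g Δv μ L N`, the (partially) Gutzwiller-projected,
number-projected `d`-wave BCS trial state `normalise (P_g P_N Π_k (u_k + v_k c†_{k↑} c†_{-k↓}) |0⟩)`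
of Gubernatis–Kawashima–Werner 2016 §9.2.2, eqs. (9.19)–(9.22) / Paramekanti–Randeria–Trivedi 2004
§IV). The fixed-node route uses this family as a GUIDING vector, which must be a REAL function on
the occupation basis, and needs to know where it vanishes on the `(N, S^z = 0)` configuration
class. Everything below is PROVED.

## Contents

* REAL GAUGE. `ProjectedBCS.conj_bcsState_apply`, `star_projectedBCSState`: the amplitudes
  `⟨s | P_g P_N BCS⟩` are real. Mechanism (folklore): the coherence factors are even,
  `u_{-k} = u_k`, `v_{-k} = v_k` (the `d_{x²-y²}` gap `Δ_k = Δv (cos k₁ - cos k₂)` is even), the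
  Jordan–Wigner matrices `c†_{xσ}` are real, and complex conjugation sends the pair creator
  `b_k = L⁻² Σ_{x,y} e^{ik·(x-y)} c†_{x↑} c†_{y↓}` to `b_{-k}`; since the Bogoliubov factors
  `u_k + v_k b_k` pairwise commute (`ProjectedBCS.commute_bogoliubovFactor`), conjugating
  `Π_k (u_k + v_k b_k) |0⟩` only permutes the factors (`prod_map_comp_equiv_univ`). Hence the real
  guiding vector `projectedBCSStateRe g Δv μ L N : Finset (Orb (FermionTorus 2 L)) → ℝ` with
  `ofReal_projectedBCSStateRe : (projectedBCSStateRe … s : ℂ) = projectedBCSState … s`,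
  `projectedBCSState_im`, `projectedBCSState_eq_ofReal`, its support
  (`projectedBCSStateRe_eq_zero_of_not_mem_class`: zero off the class
  `#s = N ∧ 2·#{o ∈ s | spin o = ↑} = N` quantified over in the route items; the counting identities
  `card_filter_spin_zero_eq_upCount`, `card_eq_upCount_add_downCount`) and its normalisation
  `sum_projectedBCSStateRe_sq` (`Σ_s φ(s)² = 1` whenever `P_g P_N |BCS⟩ ≠ 0`).
* SIGNED PERMUTATIONS ON VECTORS. `relabelVec e ψ` (`|s⟩ ↦ ε_e(s) |e s⟩`, the vector companion of
  the algebra equivalence `relabel e` of `FermionRelabelling`), `relabel_mulVec_relabelVec`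
  (`(Γ_e a Γ_e⁻¹) (Γ_e ψ) = Γ_e (a ψ)`), `relabelVec_vacuum`, `star_relabelVec_dotProduct`
  (unitarity) and the general principle of SYMMETRY-FORCED NODES
  `apply_eq_zero_of_relabelVec_apply`: if `e s = s` and `(Γ_e ψ)(s) = c ψ(s)` with `c ≠ ε_e(s)`,
  then `ψ(s) = 0` (the lattice form of the symmetry argument for nodes of fermion trial
  functions).
* THE DIAGONAL MIRROR. `ProjectedBCS.diagReflect : (x₀, x₁) ↦ (x₁, x₀)` on `FermionTorus 2 L`; it
  fixes `ξ_k`, flips `Δ_k ↦ -Δ_k`, and maps the state at gap amplitude `Δv` to the state at `-Δv`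
  EXACTLY: `relabel_diagReflect_bogoliubovFactor`
  (`Γ_R (u_k + v_k b_k)(Δv) Γ_R⁻¹ = (u_{Rk} + v_{Rk} b_{Rk})(-Δv)`) and
  `relabelVec_diagReflect_bcsState : Γ_R |BCS(Δv)⟩ = |BCS(-Δv)⟩`.
* `Δv ↦ -Δv` VERSUS THE SPIN-UP PARITY `upParity = (-1)^{N↑}`
  (`upParity_mul_creation_up_mul_upParity`: `P c†_{x↑} P = -c†_{x↑}`, `P c†_{y↓} P = c†_{y↓}`, so
  `P b_k P = -b_k`). Off the zone diagonals (`Δ_k ≠ 0`) `v_k(-Δv) = -v_k(Δv)`; ON them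
  (`cos k₁ = cos k₂`) nothing flips, and the factor is `1` (`ξ_k > 0`: `u = 1, v = 0`) or `b_k`
  (`ξ_k < 0`: `u = 0, v = 1`) PROVIDED no diagonal momentum sits exactly at the Fermi level — the
  closed-shell hypothesis `∀ k, Δ_k = 0 → ξ_k ≠ 0` (at `ξ_k = Δ_k = 0` the junk factor
  `(1 + b_k)/√2` has no parity). Then (`bcsState_neg_gap_eq`)
  `|BCS(-Δv)⟩ = (-1)^{D₋} • P |BCS(Δv)⟩`, `D₋ = diagBelowCount L Δv μ = #{k : Δ_k = 0, ξ_k < 0}`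
  (zone-diagonal momenta below the Fermi level).
* REFLECTION-FORCED EXACT ZEROS (`bcsState_eq_zero_of_diagReflect`,
  `projectedBCSState_eq_zero_of_diagReflect`, `projectedBCSStateRe_eq_zero_of_diagReflect`): under
  the closed-shell hypothesis, every configuration `s` mapped to itself by the diagonal mirror,
  `(Orb.mapEquiv diagReflect) s = s`, whose relabelling sign differs from the character,
  `relabelSign (Orb.mapEquiv diagReflect) s ≠ (-1)^{D₋ + N↑(s)}`, carries amplitude ZERO in
  `P_g P_N |BCS⟩` for every `g` and `N` (on the `(N, S^z = 0)` class `N↑(s) = N/2`,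
  `upCount_eq_half_of_mem_class`). These are symmetry-forced nodes of the intended guiding
  family of the fixed-node route (which must lift them or restrict to the support).

## Design notes

* `negMomentum` uses the additive group of `Fin L` (`[NeZero L]`); the final reality statements
  have no such hypothesis (for `L = 0` the momentum set is empty and the state is the vacuum).
* `upParity_mul_self` and `relabel_matrix_one` take the `DecidableEq` instance hidden in
  `(1 : Matrix _ _ ℂ)` as a unification binder, so that they rewrite the `1` occurring in
  `bogoliubovFactor` at the concrete orbital type whatever instance elaboration chose there (see the
  instance note in `ProjectedBCSState.lean`).
* Not here: other lattice symmetries (translations and axis mirrors act with character `+1` up to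
  the relabelling sign and force further nodes by the same principle
  `apply_eq_zero_of_relabelVec_apply`), any count of the nodal configurations, non-vanishing of
  the state.

## Sources

* J. Gubernatis, N. Kawashima, P. Werner, *Quantum Monte Carlo Methods*, CUP 2016, §9.2.2,
  eqs. (9.19)–(9.22) (`|BCS⟩ = Π_k (u_k + v_k c†_{k↑}c†_{-k↓})|0⟩`, `d`-wave `Δ_k = Δ(cos k_x - cos k_y)`,
  `|ψ_T⟩ = P_N P_G |BCS⟩`, `⟨R|P_N|BCS⟩ = det φ(r_{i↑} - r_{j↓})`, `|RVB⟩ = P_N P_G⁰|BCS⟩`).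
  [GubernatisKawashimaWerner2016]
* A. Paramekanti, M. Randeria, N. Trivedi, Phys. Rev. B 70 (2004) 054504, §IV eq. (6)
  (`φ(k) = v_k/u_k = Δ_k/(ξ_k + E_k)`, even in `k`). [ParamekantiRanderiaTrivedi2004]
* D. M. Ceperley, *Fermion nodes*, J. Stat. Phys. 63 (1991) 1237 (nodes of fermion trial functions
  forced by permutation/reflection symmetry; conceptual background only, not page-checked here).
  [Ceperley1991]
* D. F. B. ten Haaf et al., Phys. Rev. B 51 (1995) 13039 (the lattice fixed-node scheme and its
  guiding function). [TenhaafEtAl1995]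
-/

noncomputable section

namespace Literature.MathematicalPhysics.QuantumLattice

open Matrix Finset
open scoped ComplexConjugate

/-! ### Real matrices: Jordan–Wigner creators and the vacuum -/

section RealEntries

variable {ι : Type*} [LinearOrder ι]

/-- The Jordan–Wigner creation matrices are real (entries `0, ±1`); a private copy of
`creation_map_conj` of `HubbardTorusFlux.lean` (not imported, to keep this file's dependencies
small). [folklore] -/
private theorem jw_creation_map_conj (i : ι) : (creation i).map (starRingEnd ℂ) = creation i := by
  ext t s
  rw [Matrix.map_apply, creation_apply]
  split_ifs
  · simp [jwSign]
  · simp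

/-- The vacuum vector is real. [folklore] -/
theorem conj_comp_vacuum : (starRingEnd ℂ) ∘ (vacuum : Fock ι) = vacuum := by
  funext s
  simp only [Function.comp_apply, vacuum, Pi.single_apply]
  split_ifs <;> simp

variable [Fintype ι]

/-- Entrywise complex conjugation of a list product of matrices is the product of the conjugated
matrices (`Matrix.map` along a ring hom is multiplicative). [folklore] -/
theorem list_prod_map_ringHom {n : Type*} [Fintype n] [DecidableEq n] (f : ℂ →+* ℂ) :
    ∀ l : List (Matrix n n ℂ), (l.prod).map f = (l.map fun M => M.map f).prod
  | [] => by
    rw [List.prod_nil, List.map_nil, List.prod_nil, Matrix.map_one _ (_root_.map_zero f) (_root_.map_one f)]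
  | M :: l => by
    rw [List.prod_cons, List.map_cons, List.prod_cons, Matrix.map_mul, list_prod_map_ringHom f l]

/-- Products of two creation matrices are real. [folklore] -/
theorem creation_mul_creation_map_conj (a b : ι) :
    (creation a * creation b).map (starRingEnd ℂ) = creation a * creation b := by
  rw [Matrix.map_mul, jw_creation_map_conj, jw_creation_map_conj]

/-- Entrywise form of `creation_mul_creation_map_conj`. [folklore] -/
theorem conj_creation_mul_creation_apply (a b : ι) (s t : Finset ι) :
    conj ((creation a * creation b) s t) = (creation a * creation b) s t := by
  have h := congrFun (congrFun (creation_mul_creation_map_conj a b) s) t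
  rwa [Matrix.map_apply] at h

/-- Two-creator monomials pairwise commute: `c†_a c†_b` and `c†_c c†_d` commute (four fermionic
transpositions). [folklore] -/
theorem commute_creation_pair (a b c d : ι) :
    Commute (creation a * creation b) (creation c * creation d) := by
  have h := fun i j => creation_mul_creation_eq_neg (ι := ι) i j
  show creation a * creation b * (creation c * creation d) =
    creation c * creation d * (creation a * creation b)
  calc creation a * creation b * (creation c * creation d)
      = creation a * (creation b * creation c) * creation d := by simp only [mul_assoc]
    _ = -(creation a * (creation c * creation b) * creation d) := by
        rw [h b c]; simp only [mul_neg, neg_mul]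
    _ = -((creation a * creation c) * creation b * creation d) := by simp only [mul_assoc]
    _ = (creation c * creation a) * creation b * creation d := by
        rw [h a c, neg_mul, neg_mul, neg_neg]
    _ = creation c * creation a * (creation b * creation d) := by simp only [mul_assoc]
    _ = -(creation c * creation a * (creation d * creation b)) := by
        rw [h b d]; simp only [mul_neg]
    _ = -(creation c * (creation a * creation d) * creation b) := by simp only [mul_assoc]
    _ = creation c * (creation d * creation a) * creation b := by
        rw [h a d]; simp only [mul_neg, neg_mul, neg_neg]
    _ = creation c * creation d * (creation a * creation b) := by simp only [mul_assoc]

end RealEntries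

/-! ### Products over a re-enumerated index list -/

/-- The images of pairwise commuting elements along any list pairwise commute. [folklore] -/
theorem pairwise_commute_map {M κ : Type*} [Mul M] (F : κ → M) (hF : ∀ a b, Commute (F a) (F b)) :
    ∀ l : List κ, (l.map F).Pairwise Commute
  | [] => List.Pairwise.nil
  | a :: l => by
    rw [List.map_cons, List.pairwise_cons]
    refine ⟨fun b hb => ?_, pairwise_commute_map F hF l⟩
    obtain ⟨c, -, rfl⟩ := List.mem_map.1 hb
    exact hF a c

/-- For pairwise commuting `F`, the ordered product of `F` over `Finset.univ.toList` is unchanged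
by precomposing `F` with a bijection of the index type (the list is only permuted). [folklore] -/
theorem prod_map_comp_equiv_univ {M κ : Type*} [Monoid M] [Fintype κ] (e : κ ≃ κ) (F : κ → M)
    (hF : ∀ a b, Commute (F a) (F b)) :
    ((Finset.univ : Finset κ).toList.map (F ∘ e)).prod = (Finset.univ.toList.map F).prod := by
  rw [← List.map_map]
  have hperm : ((Finset.univ : Finset κ).toList.map e).Perm Finset.univ.toList :=
    Multiset.coe_eq_coe.1 (by
      rw [← Multiset.map_coe, Finset.coe_toList, Multiset.map_univ_val_equiv])
  exact (hperm.map F).prod_eq' (pairwise_commute_map F hF _)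

/-! ### Counting spins on the occupation basis -/

section Counting

variable {Λ : Type*} [LinearOrder Λ] [Fintype Λ]

/-- The orbitals of spin `σ` in a configuration are the `σ`-orbitals of the sites carrying a
`σ`-electron. [folklore] -/
theorem filter_spin_eq_map (s : Finset (Orb Λ)) (σ : Fin 2) :
    s.filter (fun o => (ofLex o).2 = σ) =
      (Finset.univ.filter fun x : Λ => orb x σ ∈ s).map
        ⟨fun x => orb x σ, fun _ _ h => (orb_eq_orb_iff.1 h).1⟩ := by
  ext o
  simp only [Finset.mem_filter, Finset.mem_map, Finset.mem_univ, true_and,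
    Function.Embedding.coeFn_mk]
  constructor
  · rintro ⟨ho, hσ⟩
    have heq : orb (ofLex o).1 (ofLex o).2 = o := rfl
    rw [hσ] at heq
    refine ⟨(ofLex o).1, ?_, heq⟩
    rw [heq]
    exact ho
  · rintro ⟨x, hx, rfl⟩
    exact ⟨hx, rfl⟩

/-- `#{o ∈ s | spin o = ↑} = N↑(s)` (`upCount` of `NagaokaTasaki`). [folklore] -/
theorem card_filter_spin_zero_eq_upCount (s : Finset (Orb Λ)) :
    (s.filter fun o => (ofLex o).2 = 0).card = upCount s := by
  rw [filter_spin_eq_map, Finset.card_map, upCount]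

/-- `#{o ∈ s | spin o = ↓} = N↓(s)`. [folklore] -/
theorem card_filter_spin_one_eq_downCount (s : Finset (Orb Λ)) :
    (s.filter fun o => (ofLex o).2 = 1).card = NagaokaTasaki.downCount s := by
  rw [filter_spin_eq_map, Finset.card_map, NagaokaTasaki.downCount]

/-- `#s = N↑(s) + N↓(s)` for every configuration. [folklore] -/
theorem card_eq_upCount_add_downCount (s : Finset (Orb Λ)) :
    s.card = upCount s + NagaokaTasaki.downCount s := by
  have hfin : ∀ σ : Fin 2, ¬σ = 0 ↔ σ = 1 := by decide
  have hfilter : s.filter (fun o : Orb Λ => ¬(ofLex o).2 = 0) = s.filter (fun o => (ofLex o).2 = 1) :=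
    Finset.filter_congr fun o _ => hfin _
  rw [← card_filter_spin_zero_eq_upCount, ← card_filter_spin_one_eq_downCount, ← hfilter,
    Finset.card_filter_add_card_filter_not]

/-- On the `(N, S^z = 0)` class of the route items (`#s = N ∧ 2 · #{spin ↑} = N`), `N↑(s) = N/2`
and `N↓(s) = N/2`. [folklore] -/
theorem upCount_eq_half_of_mem_class {s : Finset (Orb Λ)} {N : ℕ}
    (h : s.card = N ∧ 2 * (s.filter fun o => (ofLex o).2 = 0).card = N) :
    upCount s = N / 2 ∧ NagaokaTasaki.downCount s = N / 2 := by
  obtain ⟨h1, h2⟩ := h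
  rw [card_filter_spin_zero_eq_upCount] at h2
  have h3 := card_eq_upCount_add_downCount s
  omega

/-- Adding an up electron raises `N↑` by one. [folklore] -/
theorem upCount_insert_orb_zero {s : Finset (Orb Λ)} {x : Λ} (h : orb x 0 ∉ s) :
    upCount (insert (orb x 0) s) = upCount s + 1 := by
  have := upCount_erase_orb_zero (s := insert (orb x 0) s) (x := x) (Finset.mem_insert_self _ _)
  rw [Finset.erase_insert h] at this
  omega

/-- Adding a down electron does not change `N↑`. [folklore] -/
theorem upCount_insert_orb_one (s : Finset (Orb Λ)) (y : Λ) :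
    upCount (insert (orb y 1) s) = upCount s := by
  by_cases h : orb y 1 ∈ s
  · rw [Finset.insert_eq_of_mem h]
  · have := upCount_erase_orb_one (insert (orb y 1) s) y
    rw [Finset.erase_insert h] at this
    exact this.symm

/-- `N↑(∅) = 0`. [folklore] -/
@[simp] theorem upCount_empty : upCount (∅ : Finset (Orb Λ)) = 0 := by
  simp [upCount]

end Counting

/-! ### The spin-up parity `(-1)^{N↑}` -/

section UpParity

variable {Λ : Type*} [LinearOrder Λ] [Fintype Λ]

/-- The spin-up parity operator `P = (-1)^{N↑}`, diagonal in the occupation basis. It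
anticommutes with every `c†_{x↑}` and commutes with every `c†_{y↓}`, hence flips the sign of every
singlet pair creator `c†_{x↑} c†_{y↓}`. [folklore] -/
def upParity : Matrix (Finset (Orb Λ)) (Finset (Orb Λ)) ℂ :=
  Matrix.diagonal fun s => (-1) ^ upCount s

/-- Entries of `P`: `P_{st} = [s = t] (-1)^{N↑(s)}`. [folklore] -/
theorem upParity_apply (s t : Finset (Orb Λ)) :
    (upParity : Matrix (Finset (Orb Λ)) (Finset (Orb Λ)) ℂ) s t = if s = t then (-1) ^ upCount s else 0 := by
  rw [upParity, diagonal_apply]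

/-- `(P ψ)(s) = (-1)^{N↑(s)} ψ(s)`. [folklore] -/
theorem upParity_mulVec_apply (ψ : Fock (Orb Λ)) (s : Finset (Orb Λ)) :
    (upParity *ᵥ ψ) s = (-1) ^ upCount s * ψ s := by
  rw [upParity, mulVec_diagonal]

/-- `(P X)_{st} = (-1)^{N↑(s)} X_{st}`. [folklore] -/
theorem upParity_mul_apply (X : Matrix (Finset (Orb Λ)) (Finset (Orb Λ)) ℂ) (s t : Finset (Orb Λ)) :
    (upParity (Λ := Λ) * X) s t = (-1) ^ upCount s * X s t := by
  rw [upParity, diagonal_mul]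

/-- `(X P)_{st} = X_{st} (-1)^{N↑(t)}`. [folklore] -/
theorem mul_upParity_apply (X : Matrix (Finset (Orb Λ)) (Finset (Orb Λ)) ℂ) (s t : Finset (Orb Λ)) :
    (X * upParity (Λ := Λ)) s t = X s t * (-1) ^ upCount t := by
  rw [upParity, mul_diagonal]

/-- `(-1)^n (-1)^n = 1` in `ℂ`. [folklore] -/
theorem neg_one_pow_mul_neg_one_pow (n : ℕ) : ((-1 : ℂ) ^ n) * (-1) ^ n = 1 := by
  rw [← pow_add, ← two_mul, pow_mul, neg_one_sq, one_pow]

/-- `P (P X) = X` (`P² = 1`, stated without the unit matrix). [folklore] -/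
theorem upParity_mul_upParity_mul (X : Matrix (Finset (Orb Λ)) (Finset (Orb Λ)) ℂ) :
    upParity * (upParity * X) = X := by
  ext s t
  rw [upParity_mul_apply, upParity_mul_apply, ← mul_assoc, neg_one_pow_mul_neg_one_pow, one_mul]

/-- `P² = 1`, for whichever `DecidableEq` instance the unit matrix carries (unification binder).
[folklore] -/
theorem upParity_mul_self {inst : DecidableEq (Finset (Orb Λ))} :
    upParity * upParity = (1 : Matrix (Finset (Orb Λ)) (Finset (Orb Λ)) ℂ) := by
  ext s t
  rw [upParity_mul_apply, upParity_apply, Matrix.one_apply]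
  split_ifs with h
  · subst h; exact neg_one_pow_mul_neg_one_pow _
  · rw [mul_zero]

/-- `P (P ψ) = ψ`. [folklore] -/
theorem upParity_mulVec_upParity_mulVec (ψ : Fock (Orb Λ)) : upParity *ᵥ (upParity *ᵥ ψ) = ψ := by
  funext s
  rw [upParity_mulVec_apply, upParity_mulVec_apply, ← mul_assoc, neg_one_pow_mul_neg_one_pow, one_mul]

/-- `P |0⟩ = |0⟩`. [folklore] -/
theorem upParity_mulVec_vacuum : upParity *ᵥ (vacuum : Fock (Orb Λ)) = vacuum := by
  funext s
  rw [upParity_mulVec_apply]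
  by_cases hs : s = ∅
  · subst hs; rw [upCount_empty, pow_zero, one_mul]
  · simp [vacuum, hs]

/-- `P c†_{x↑} P = -c†_{x↑}`. [folklore] -/
theorem upParity_mul_creation_up_mul_upParity (x : Λ) :
    upParity * creation (orb x 0) * upParity = -creation (orb x 0) := by
  ext t s
  rw [mul_upParity_apply, upParity_mul_apply, Matrix.neg_apply, creation_apply]
  split_ifs with h
  · obtain ⟨hx, rfl⟩ := h
    rw [upCount_insert_orb_zero hx, pow_succ]
    calc (-1) ^ upCount s * -1 * jwSign (orb x 0) s * (-1) ^ upCount s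
        = -(((-1 : ℂ) ^ upCount s * (-1) ^ upCount s) * jwSign (orb x 0) s) := by ring
      _ = -jwSign (orb x 0) s := by rw [neg_one_pow_mul_neg_one_pow, one_mul]
  · rw [mul_zero, zero_mul, neg_zero]

/-- `P c†_{y↓} P = c†_{y↓}`. [folklore] -/
theorem upParity_mul_creation_down_mul_upParity (y : Λ) :
    upParity * creation (orb y 1) * upParity = creation (orb y 1) := by
  ext t s
  rw [mul_upParity_apply, upParity_mul_apply, creation_apply]
  split_ifs with h
  · obtain ⟨_, rfl⟩ := h
    rw [upCount_insert_orb_one]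
    calc (-1) ^ upCount s * jwSign (orb y 1) s * (-1) ^ upCount s
        = ((-1 : ℂ) ^ upCount s * (-1) ^ upCount s) * jwSign (orb y 1) s := by ring
      _ = jwSign (orb y 1) s := by rw [neg_one_pow_mul_neg_one_pow, one_mul]
  · rw [mul_zero, zero_mul]

/-- `P (c†_{x↑} c†_{y↓}) P = -(c†_{x↑} c†_{y↓})`: singlet pair creators are parity-odd. [folklore] -/
theorem upParity_mul_pair_mul_upParity (x y : Λ) :
    upParity * (creation (orb x 0) * creation (orb y 1)) * upParity =
      -(creation (orb x 0) * creation (orb y 1)) := by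
  calc upParity * (creation (orb x 0) * creation (orb y 1)) * upParity
      = (upParity * creation (orb x 0) * upParity) * (upParity * creation (orb y 1) * upParity) := by
        simp only [mul_assoc]; rw [upParity_mul_upParity_mul]
    _ = -(creation (orb x 0) * creation (orb y 1)) := by
        rw [upParity_mul_creation_up_mul_upParity, upParity_mul_creation_down_mul_upParity, neg_mul]

/-- Telescoping a list of `P`-conjugates with scalar weights:
`Π_m c_m (P f_m P) = (Π_m c_m) · P (Π_m f_m) P` whenever `P (P X) = X`. [folklore] -/
theorem list_prod_map_smul_conj {A : Type*} [Ring A] [Algebra ℂ A] (P : A)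
    (hP : ∀ X, P * (P * X) = X) {κ : Type*} (c : κ → ℂ) (f : κ → A) :
    ∀ l : List κ, (l.map fun m => c m • (P * f m * P)).prod =
      (l.map c).prod • (P * (l.map f).prod * P)
  | [] => by
    have h := hP 1
    rw [mul_one] at h
    simp only [List.map_nil, List.prod_nil, one_smul, mul_one]
    exact h.symm
  | m :: l => by
    simp only [List.map_cons, List.prod_cons]
    rw [list_prod_map_smul_conj P hP c f l, Algebra.smul_mul_assoc, Algebra.mul_smul_comm, smul_smul]
    congr 1
    simp only [mul_assoc]
    rw [hP]

end UpParity

/-! ### Signed permutations of Fock vectors and symmetry-forced nodes -/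

section RelabelVec

variable {ι ι' : Type*} [LinearOrder ι] [LinearOrder ι'] [Fintype ι] [Fintype ι'] (e : ι ≃ ι')

/-- The signed permutation of Fock VECTORS implementing the orbital bijection `e`:
`|s⟩ ↦ ε_e(s) |e s⟩`, i.e. `(Γ_e ψ)(e s) = ε_e(s) ψ(s)` — the unitary whose conjugation action on
matrices is `relabel e` of `FermionRelabelling`. [cite: BratteliRobinsonII1997, §5.2.2, Thm. 5.2.5 (unitarily implemented Bogoliubov transformations)] -/
def relabelVec (ψ : Fock ι) : Fock ι' := fun t =>
  relabelSign e (e.finsetCongr.symm t) * ψ (e.finsetCongr.symm t)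

omit [Fintype ι] [Fintype ι'] in
/-- `(Γ_e ψ)(e s) = ε_e(s) ψ(s)`. [folklore] -/
theorem relabelVec_apply_finsetCongr (ψ : Fock ι) (s : Finset ι) :
    relabelVec e ψ (e.finsetCongr s) = relabelSign e s * ψ s := by
  simp only [relabelVec, Equiv.symm_apply_apply]

/-- `(Γ a Γ⁻¹)(Γ ψ) = Γ (a ψ)`: the matrix relabelling is conjugation by the vector relabelling.
[folklore] -/
theorem relabel_mulVec_relabelVec (a : Matrix (Finset ι) (Finset ι) ℂ) (ψ : Fock ι) :
    relabel e a *ᵥ relabelVec e ψ = relabelVec e (a *ᵥ ψ) := by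
  funext t'
  obtain ⟨t, rfl⟩ := e.finsetCongr.surjective t'
  rw [relabelVec_apply_finsetCongr]
  simp only [mulVec, dotProduct]
  rw [Finset.mul_sum,
    show ∑ s', relabel e a (e.finsetCongr t) s' * relabelVec e ψ s' =
      ∑ s, relabel e a (e.finsetCongr t) (e.finsetCongr s) * relabelVec e ψ (e.finsetCongr s) from
    (Equiv.sum_comp e.finsetCongr _).symm]
  refine Finset.sum_congr rfl fun s _ => ?_
  rw [relabel_apply_finsetCongr, relabelVec_apply_finsetCongr, mul_assoc, mul_assoc,
    ← mul_assoc (relabelSign e s), relabelSign_mul_self, one_mul]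

omit [Fintype ι] [Fintype ι'] in
/-- `Γ |0⟩ = |0⟩`. [folklore] -/
theorem relabelVec_vacuum : relabelVec e (vacuum : Fock ι) = vacuum := by
  funext t'
  obtain ⟨t, rfl⟩ := e.finsetCongr.surjective t'
  rw [relabelVec_apply_finsetCongr]
  by_cases ht : t = ∅
  · subst ht
    have h1 : e.finsetCongr (∅ : Finset ι) = ∅ := by
      rw [Equiv.finsetCongr_apply, Finset.map_empty]
    rw [h1]
    simp [vacuum, relabelSign, invCount]
  · have ht' : e.finsetCongr t ≠ ∅ := by
      rwa [Ne, Equiv.finsetCongr_apply, Finset.map_eq_empty]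
    simp [vacuum, ht]

/-- `Γ_e` is unitary: `⟨Γ ψ, Γ φ⟩ = ⟨ψ, φ⟩`. [folklore] -/
theorem star_relabelVec_dotProduct (ψ φ : Fock ι) :
    star (relabelVec e ψ) ⬝ᵥ relabelVec e φ = star ψ ⬝ᵥ φ := by
  rw [dotProduct, dotProduct]
  symm
  refine Fintype.sum_equiv e.finsetCongr _ _ fun s => ?_
  rw [Pi.star_apply, Pi.star_apply, relabelVec_apply_finsetCongr, relabelVec_apply_finsetCongr,
    star_mul', star_relabelSign]
  calc star (ψ s) * φ s = (relabelSign e s * relabelSign e s) * (star (ψ s) * φ s) := by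
        rw [relabelSign_mul_self, one_mul]
    _ = relabelSign e s * star (ψ s) * (relabelSign e s * φ s) := by ring

variable {e}

omit [Fintype ι] in
/-- **Symmetry-forced nodes.** If a configuration `s` is mapped to itself by the orbital
bijection `e` and the transformed vector satisfies `(Γ_e ψ)(s) = c · ψ(s)` with `c ≠ ε_e(s)`, then
`ψ(s) = 0` (because also `(Γ_e ψ)(s) = (Γ_e ψ)(e s) = ε_e(s) ψ(s)`). The lattice version of the
symmetry argument for nodes of fermion trial functions. [folklore] -/
theorem apply_eq_zero_of_relabelVec_apply {e : ι ≃ ι} {ψ : Fock ι} {s : Finset ι} {c : ℂ}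
    (hs : e.finsetCongr s = s) (h : relabelVec e ψ s = c * ψ s) (hc : c ≠ relabelSign e s) :
    ψ s = 0 := by
  have h' := relabelVec_apply_finsetCongr e ψ s
  rw [hs, h] at h'
  have h'' : (c - relabelSign e s) * ψ s = 0 := by rw [sub_mul, h', sub_self]
  rcases mul_eq_zero.1 h'' with h1 | h1
  · exact absurd (sub_eq_zero.1 h1) hc
  · exact h1

/-- The unit matrix is invariant under relabelling along a bijection of `ι`, for whichever
`DecidableEq` instance the unit matrix carries (unification binder). [folklore] -/
theorem relabel_matrix_one {inst : DecidableEq (Finset ι)} (e : ι ≃ ι) :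
    relabel e (1 : Matrix (Finset ι) (Finset ι) ℂ) = 1 := by
  ext s' t'
  obtain ⟨s, rfl⟩ := e.finsetCongr.surjective s'
  obtain ⟨t, rfl⟩ := e.finsetCongr.surjective t'
  rw [relabel_apply_finsetCongr, Matrix.one_apply, Matrix.one_apply]
  by_cases h : s = t
  · subst h
    rw [if_pos rfl, if_pos rfl, mul_one, relabelSign_mul_self]
  · rw [if_neg h, if_neg (e.finsetCongr.injective.ne h), mul_zero, zero_mul]

/-- `Γ (A B) Γ⁻¹ = (Γ A Γ⁻¹)(Γ B Γ⁻¹)` (restated from `map_mul` once, at the abstract orbital type,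
so that users at concrete lattices need no hom-class instance search). [folklore] -/
theorem relabel_map_mul (e : ι ≃ ι') (A B : Matrix (Finset ι) (Finset ι) ℂ) :
    relabel e (A * B) = relabel e A * relabel e B :=
  _root_.map_mul _ _ _

/-- `Γ (A + B) Γ⁻¹ = Γ A Γ⁻¹ + Γ B Γ⁻¹`. [folklore] -/
theorem relabel_map_add (e : ι ≃ ι') (A B : Matrix (Finset ι) (Finset ι) ℂ) :
    relabel e (A + B) = relabel e A + relabel e B :=
  _root_.map_add _ _ _

/-- `Γ (a • A) Γ⁻¹ = a • Γ A Γ⁻¹`. [folklore] -/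
theorem relabel_map_smul (e : ι ≃ ι') (a : ℂ) (A : Matrix (Finset ι) (Finset ι) ℂ) :
    relabel e (a • A) = a • relabel e A :=
  _root_.map_smul _ _ _

/-- A unital multiplicative map takes ordered list products to ordered list products (`map_list_prod`
with the homomorphism property supplied as hypotheses). [folklore] -/
theorem list_prod_map_of_mul {A B : Type*} [Mul A] [One A] [Mul B] [One B] (φ : A → B) (h1 : φ 1 = 1)
    (hmul : ∀ x y, φ (x * y) = φ x * φ y) : ∀ l : List A, φ l.prod = (l.map φ).prod
  | [] => by rw [List.prod_nil, List.map_nil, List.prod_nil, h1]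
  | x :: l => by rw [List.prod_cons, List.map_cons, List.prod_cons, hmul, list_prod_map_of_mul φ h1 hmul l]

variable {Λ Λ' : Type*} [LinearOrder Λ] [LinearOrder Λ'] [Fintype Λ] [Fintype Λ']

/-- Covariance of a general singlet-pair bilinear `Σ_{x,y} c(x,y) c†_{x↑} c†_{y↓}` under a site
bijection `f`: `Γ_f (·) Γ_f⁻¹ = Σ_{x,y} c(x,y) c†_{f x,↑} c†_{f y,↓}`. [folklore] -/
theorem relabel_mapEquiv_sum_sum_smul_pair (f : Λ ≃ Λ') (c : Λ → Λ → ℂ) :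
    relabel (Orb.mapEquiv f) (∑ x, ∑ y, c x y • (creation (orb x 0) * creation (orb y 1))) =
      ∑ x, ∑ y, c x y • (creation (orb (f x) 0) * creation (orb (f y) 1)) := by
  rw [_root_.map_sum]
  refine Finset.sum_congr rfl fun x _ => ?_
  rw [_root_.map_sum]
  refine Finset.sum_congr rfl fun y _ => ?_
  rw [_root_.map_smul, _root_.map_mul, relabel_creation, relabel_creation, Orb.mapEquiv_orb,
    Orb.mapEquiv_orb]

/-- Site bijections preserve the number of up spins: `N↑(e s) = N↑(s)`. [folklore] -/
theorem upCount_finsetCongr_mapEquiv (f : Λ ≃ Λ') (s : Finset (Orb Λ)) :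
    upCount ((Orb.mapEquiv f).finsetCongr s) = upCount s := by
  unfold upCount
  rw [← Finset.card_map f.toEmbedding]
  congr 1
  ext x'
  simp only [Finset.mem_map_equiv, Finset.mem_filter, Finset.mem_univ, true_and]
  rw [← apply_mem_finsetCongr (Orb.mapEquiv f) (orb (f.symm x') 0) s, Orb.mapEquiv_orb,
    Equiv.apply_symm_apply]

end RelabelVec

namespace ProjectedBCS

variable {L : ℕ}

/-! ### Momentum reversal `k ↦ -k` and the reality of the BCS data -/

/-- Momentum reversal `n ↦ -n` (componentwise in the additive group `Fin L`), i.e. `k ↦ -k` for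
`k = 2πn/L`. [folklore] -/
def negMomentum [NeZero L] (n : FermionTorus 2 L) : FermionTorus 2 L := toLex fun i => -(ofLex n i)

/-- Components of `-n`. [folklore] -/
@[simp] theorem ofLex_negMomentum_apply [NeZero L] (n : FermionTorus 2 L) (i : Fin 2) :
    ofLex (negMomentum n) i = -(ofLex n i) := rfl

/-- `-(-n) = n`. [folklore] -/
theorem negMomentum_negMomentum [NeZero L] (n : FermionTorus 2 L) :
    negMomentum (negMomentum n) = n := by
  show toLex (fun i => -(-(ofLex n i))) = n
  simp only [neg_neg]
  rfl

/-- Momentum reversal as an involutive bijection. [folklore] -/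
def negMomentumEquiv [NeZero L] : FermionTorus 2 L ≃ FermionTorus 2 L :=
  ⟨negMomentum, negMomentum, negMomentum_negMomentum, negMomentum_negMomentum⟩

/-- `negMomentumEquiv` is `negMomentum`. [folklore] -/
@[simp] theorem negMomentumEquiv_apply [NeZero L] (n : FermionTorus 2 L) :
    negMomentumEquiv n = negMomentum n := rfl

/-- Representatives: `(-a) + a` is a multiple of `L` (namely `0` or `L`). [folklore] -/
theorem exists_val_neg_add_val [NeZero L] (a : Fin L) :
    ∃ c : ℕ, ((-a : Fin L) : ℕ) + (a : ℕ) = c * L := by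
  have h : (((-a : Fin L) : ℕ) + (a : ℕ)) % L = 0 := by
    rw [← Fin.val_add, neg_add_cancel]
    simp
  obtain ⟨c, hc⟩ := Nat.dvd_of_mod_eq_zero h
  exact ⟨c, by rw [hc, mul_comm]⟩

/-- Real form of `exists_val_neg_add_val`: `((-a : Fin L) : ℝ) = c L - a`. [folklore] -/
theorem exists_cast_val_neg [NeZero L] (a : Fin L) :
    ∃ c : ℕ, (((-a : Fin L) : ℕ) : ℝ) = c * L - (a : ℕ) := by
  obtain ⟨c, hc⟩ := exists_val_neg_add_val a
  refine ⟨c, ?_⟩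
  have h := congrArg (Nat.cast (R := ℝ)) hc
  rw [Nat.cast_add, Nat.cast_mul] at h
  linarith

/-- `cos (-k)_i = cos k_i`. [folklore] -/
theorem cosMomentum_negMomentum [NeZero L] (n : FermionTorus 2 L) (i : Fin 2) :
    cosMomentum L (negMomentum n) i = cosMomentum L n i := by
  obtain ⟨c, hc⟩ := exists_cast_val_neg (ofLex n i)
  have hL : (L : ℝ) ≠ 0 := Nat.cast_ne_zero.2 (NeZero.ne L)
  have h2 : 2 * Real.pi * ((c : ℝ) * L) / L = c * (2 * Real.pi) := by
    rw [div_eq_iff hL]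
    ring
  unfold cosMomentum
  rw [ofLex_negMomentum_apply, hc, mul_sub, sub_div, h2]
  exact Real.cos_nat_mul_two_pi_sub _ c

/-- `ξ_{-k} = ξ_k`. [folklore] -/
theorem bandXi_negMomentum [NeZero L] (μ : ℝ) (n : FermionTorus 2 L) :
    bandXi L μ (negMomentum n) = bandXi L μ n := by
  simp only [bandXi, cosMomentum_negMomentum]

/-- `Δ_{-k} = Δ_k` (the `d_{x²-y²}` gap is even). [folklore] -/
theorem gapDelta_negMomentum [NeZero L] (Δv : ℝ) (n : FermionTorus 2 L) :
    gapDelta L Δv (negMomentum n) = gapDelta L Δv n := by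
  simp only [gapDelta, cosMomentum_negMomentum]

/-- `E_{-k} = E_k`. [folklore] -/
theorem bogoliubovE_negMomentum [NeZero L] (Δv μ : ℝ) (n : FermionTorus 2 L) :
    bogoliubovE L Δv μ (negMomentum n) = bogoliubovE L Δv μ n := by
  simp only [bogoliubovE, bandXi_negMomentum, gapDelta_negMomentum]

/-- `u_{-k} = u_k`. [cite: ParamekantiRanderiaTrivedi2004, §IV eq. (6)] -/
theorem cohU_negMomentum [NeZero L] (Δv μ : ℝ) (n : FermionTorus 2 L) :
    cohU L Δv μ (negMomentum n) = cohU L Δv μ n := by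
  simp only [cohU, bandXi_negMomentum, bogoliubovE_negMomentum]

/-- `v_{-k} = v_k`. [cite: ParamekantiRanderiaTrivedi2004, §IV eq. (6)] -/
theorem cohV_negMomentum [NeZero L] (Δv μ : ℝ) (n : FermionTorus 2 L) :
    cohV L Δv μ (negMomentum n) = cohV L Δv μ n := by
  simp only [cohV, bandXi_negMomentum, gapDelta_negMomentum, bogoliubovE_negMomentum]

/-- `(-k) · x ≡ -(k · x)` modulo `2π`: `phase (-n) x = 2π m - phase n x` for a natural number `m`.
[folklore] -/
theorem phase_negMomentum [NeZero L] (n x : FermionTorus 2 L) :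
    ∃ m : ℕ, phase L (negMomentum n) x = m * (2 * Real.pi) - phase L n x := by
  obtain ⟨c₀, h₀⟩ := exists_cast_val_neg (ofLex n 0)
  obtain ⟨c₁, h₁⟩ := exists_cast_val_neg (ofLex n 1)
  refine ⟨c₀ * (ofLex x 0 : ℕ) + c₁ * (ofLex x 1 : ℕ), ?_⟩
  have hL : (L : ℝ) ≠ 0 := Nat.cast_ne_zero.2 (NeZero.ne L)
  unfold phase
  rw [ofLex_negMomentum_apply, ofLex_negMomentum_apply]
  simp only [Nat.cast_add, Nat.cast_mul]
  rw [h₀, h₁, eq_sub_iff_add_eq, ← add_div, div_eq_iff hL]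
  ring

/-- Complex conjugation reverses the momentum of the plane-wave coefficient
`e^{ik·(x-y)}`. [folklore] -/
theorem cexp_phase_negMomentum [NeZero L] (n x y : FermionTorus 2 L) :
    Complex.exp (Complex.I * ((phase L (negMomentum n) x - phase L (negMomentum n) y : ℝ) : ℂ)) =
      conj (Complex.exp (Complex.I * ((phase L n x - phase L n y : ℝ) : ℂ))) := by
  obtain ⟨mx, hx⟩ := phase_negMomentum n x
  obtain ⟨my, hy⟩ := phase_negMomentum n y
  rw [← Complex.exp_conj, _root_.map_mul, Complex.conj_I, Complex.conj_ofReal, hx, hy,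
    Complex.exp_eq_exp_iff_exists_int]
  refine ⟨(mx : ℤ) - my, ?_⟩
  push_cast
  ring

/-- Complex conjugation of the pair creator reverses its momentum: `conj b_k = b_{-k}` (entrywise;
the Jordan–Wigner matrices are real). [folklore] -/
theorem pairCreation_map_conj [NeZero L] (n : FermionTorus 2 L) :
    (pairCreation L n).map (starRingEnd ℂ) = pairCreation L (negMomentum n) := by
  ext s t
  rw [Matrix.map_apply, pairCreation, pairCreation, Matrix.sum_apply, Matrix.sum_apply,
    _root_.map_sum]
  refine Finset.sum_congr rfl fun x _ => ?_
  rw [Matrix.sum_apply, Matrix.sum_apply, _root_.map_sum]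
  refine Finset.sum_congr rfl fun y _ => ?_
  rw [Matrix.smul_apply, Matrix.smul_apply, smul_eq_mul, smul_eq_mul, _root_.map_mul,
    _root_.map_div₀, cexp_phase_negMomentum, conj_creation_mul_creation_apply, _root_.map_pow,
    _root_.map_natCast]

/-- Complex conjugation of a Bogoliubov factor reverses its momentum:
`conj (u_k + v_k b_k) = u_{-k} + v_{-k} b_{-k}`. [folklore] -/
theorem bogoliubovFactor_map_conj [NeZero L] (Δv μ : ℝ) (n : FermionTorus 2 L) :
    (bogoliubovFactor L Δv μ n).map (starRingEnd ℂ) = bogoliubovFactor L Δv μ (negMomentum n) := by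
  ext s t
  have hb := congrFun (congrFun (pairCreation_map_conj n) s) t
  rw [Matrix.map_apply] at hb
  simp only [bogoliubovFactor, Matrix.map_apply, Matrix.add_apply, Matrix.smul_apply, smul_eq_mul,
    _root_.map_add, _root_.map_mul, Complex.conj_ofReal, hb, cohU_negMomentum, cohV_negMomentum,
    Matrix.one_apply]
  congr 1
  split_ifs <;> simp

/-- The Bogoliubov factors pairwise commute (they are even in the fermions). [folklore] -/
theorem commute_bogoliubovFactor (Δv μ Δv' μ' : ℝ) (n m : FermionTorus 2 L) :
    Commute (bogoliubovFactor L Δv μ n) (bogoliubovFactor L Δv' μ' m) := by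
  have hb : Commute (pairCreation L n) (pairCreation L m) := by
    unfold pairCreation
    refine Commute.sum_left _ _ _ fun x _ => Commute.sum_left _ _ _ fun y _ =>
      Commute.sum_right _ _ _ fun x' _ => Commute.sum_right _ _ _ fun y' _ => ?_
    exact ((commute_creation_pair _ _ _ _).smul_left _).smul_right _
  unfold bogoliubovFactor
  refine Commute.add_left (Commute.add_right ?_ ?_) (Commute.add_right ?_ ?_)
  · exact ((Commute.one_left _).smul_left _).smul_right _
  · exact ((Commute.one_left _).smul_left _).smul_right _
  · exact ((Commute.one_right _).smul_left _).smul_right _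
  · exact (hb.smul_left _).smul_right _

/-- **The `d`-wave BCS state is real in the occupation basis**: `conj ⟨s|BCS⟩ = ⟨s|BCS⟩` for every
configuration `s` (even coherence factors `u_{-k} = u_k`, `v_{-k} = v_k`, real Jordan–Wigner
matrices, commuting factors). [folklore] -/
theorem conj_bcsState_apply (Δv μ : ℝ) (s : Finset (Orb (FermionTorus 2 L))) :
    conj (bcsState L Δv μ s) = bcsState L Δv μ s := by
  rcases isEmpty_or_nonempty (FermionTorus 2 L) with hL | ⟨⟨n₀⟩⟩
  · have h : bcsState L Δv μ = vacuum := by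
      unfold bcsState
      rw [Finset.univ_eq_empty_iff.2 hL, Finset.toList_empty, List.map_nil, List.prod_nil, one_mulVec]
    rw [h]
    exact congrFun (conj_comp_vacuum (ι := Orb (FermionTorus 2 L))) s
  · haveI : NeZero L := ⟨(Fin.pos (ofLex n₀ 0)).ne'⟩
    suffices hP : ((Finset.univ.toList.map (bogoliubovFactor L Δv μ)).prod).map (starRingEnd ℂ) =
        (Finset.univ.toList.map (bogoliubovFactor L Δv μ)).prod by
      unfold bcsState
      rw [RingHom.map_mulVec, conj_comp_vacuum, hP]
    rw [list_prod_map_ringHom, List.map_map]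
    have hcomp : ((fun M : Matrix (Finset (Orb (FermionTorus 2 L))) (Finset (Orb (FermionTorus 2 L))) ℂ =>
        M.map (starRingEnd ℂ)) ∘ bogoliubovFactor L Δv μ) = bogoliubovFactor L Δv μ ∘ negMomentumEquiv := by
      funext n
      simp only [Function.comp_apply, bogoliubovFactor_map_conj, negMomentumEquiv_apply]
    rw [hcomp]
    exact prod_map_comp_equiv_univ negMomentumEquiv _ (commute_bogoliubovFactor Δv μ Δv μ)

variable (L) in
/-- Vector form: `star |BCS⟩ = |BCS⟩`. [folklore] -/
theorem star_bcsState (Δv μ : ℝ) : star (bcsState L Δv μ) = bcsState L Δv μ :=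
  funext fun s => conj_bcsState_apply Δv μ s

/-! ### The diagonal mirror `(x₀, x₁) ↦ (x₁, x₀)` -/

/-- The diagonal mirror of the torus `(ℤ/Lℤ)²`, `(x₀, x₁) ↦ (x₁, x₀)` (on sites and on momenta).
[folklore] -/
def diagReflect : FermionTorus 2 L ≃ FermionTorus 2 L where
  toFun x := toLex fun i => ofLex x i.rev
  invFun x := toLex fun i => ofLex x i.rev
  left_inv x := by
    show (fun i => (ofLex x) i.rev.rev) = ofLex x
    funext i
    rw [Fin.rev_rev]
  right_inv x := by
    show (fun i => (ofLex x) i.rev.rev) = ofLex x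
    funext i
    rw [Fin.rev_rev]

/-- Components of the mirrored point. [folklore] -/
@[simp] theorem ofLex_diagReflect (x : FermionTorus 2 L) (i : Fin 2) :
    ofLex (diagReflect x) i = ofLex x i.rev := rfl

/-- The mirror is an involution. [folklore] -/
@[simp] theorem diagReflect_diagReflect (x : FermionTorus 2 L) : diagReflect (diagReflect x) = x :=
  diagReflect.left_inv x

/-- `rev 0 = 1` in `Fin 2`. [folklore] -/
private theorem fin_two_rev_zero : (0 : Fin 2).rev = 1 := by decide

/-- `rev 1 = 0` in `Fin 2`. [folklore] -/
private theorem fin_two_rev_one : (1 : Fin 2).rev = 0 := by decide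

/-- `ξ` is mirror-symmetric. [folklore] -/
theorem bandXi_diagReflect (μ : ℝ) (n : FermionTorus 2 L) :
    bandXi L μ (diagReflect n) = bandXi L μ n := by
  simp only [bandXi, cosMomentum, ofLex_diagReflect, fin_two_rev_zero, fin_two_rev_one]
  ring

/-- The `d_{x²-y²}` gap is mirror-odd: `Δ_{R k} = -Δ_k`. [cite: GubernatisKawashimaWerner2016, §9.2.2 eq. (9.20)] -/
theorem gapDelta_diagReflect (Δv : ℝ) (n : FermionTorus 2 L) :
    gapDelta L Δv (diagReflect n) = -gapDelta L Δv n := by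
  simp only [gapDelta, cosMomentum, ofLex_diagReflect, fin_two_rev_zero, fin_two_rev_one]
  ring

/-- Equivalently `Δ_{R k}(-Δv) = Δ_k(Δv)`. [folklore] -/
theorem gapDelta_neg_diagReflect (Δv : ℝ) (n : FermionTorus 2 L) :
    gapDelta L (-Δv) (diagReflect n) = gapDelta L Δv n := by
  rw [gapDelta_diagReflect, gapDelta, gapDelta]
  ring

/-- `E_{R k}(-Δv) = E_k(Δv)`. [folklore] -/
theorem bogoliubovE_neg_diagReflect (Δv μ : ℝ) (n : FermionTorus 2 L) :
    bogoliubovE L (-Δv) μ (diagReflect n) = bogoliubovE L Δv μ n := by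
  rw [bogoliubovE, bogoliubovE, bandXi_diagReflect, gapDelta_neg_diagReflect]

/-- `u_{R k}(-Δv) = u_k(Δv)`. [folklore] -/
theorem cohU_neg_diagReflect (Δv μ : ℝ) (n : FermionTorus 2 L) :
    cohU L (-Δv) μ (diagReflect n) = cohU L Δv μ n := by
  rw [cohU, cohU, bandXi_diagReflect, bogoliubovE_neg_diagReflect]

/-- `v_{R k}(-Δv) = v_k(Δv)`. [folklore] -/
theorem cohV_neg_diagReflect (Δv μ : ℝ) (n : FermionTorus 2 L) :
    cohV L (-Δv) μ (diagReflect n) = cohV L Δv μ n := by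
  rw [cohV, cohV, gapDelta_neg_diagReflect, bandXi_diagReflect, bogoliubovE_neg_diagReflect]

/-- `(R k) · (R x) = k · x`. [folklore] -/
theorem phase_diagReflect_diagReflect (n x : FermionTorus 2 L) :
    phase L (diagReflect n) (diagReflect x) = phase L n x := by
  simp only [phase, ofLex_diagReflect, fin_two_rev_zero, fin_two_rev_one]
  push_cast
  ring

/-- **Covariance of the pair creator under the diagonal mirror**: `Γ_R b_k Γ_R⁻¹ = b_{R k}`.
[folklore] -/
theorem relabel_diagReflect_pairCreation (n : FermionTorus 2 L) :
    relabel (Orb.mapEquiv diagReflect) (pairCreation L n) = pairCreation L (diagReflect n) := by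
  unfold pairCreation
  rw [relabel_mapEquiv_sum_sum_smul_pair]
  refine Fintype.sum_equiv diagReflect _ _ fun x => ?_
  refine Fintype.sum_equiv diagReflect _ _ fun y => ?_
  rw [phase_diagReflect_diagReflect, phase_diagReflect_diagReflect]

/-- **Covariance of the Bogoliubov factors**: the mirror maps the factor of momentum `k` at gap
amplitude `Δv` to the factor of momentum `R k` at gap amplitude `-Δv`, exactly. [folklore] -/
theorem relabel_diagReflect_bogoliubovFactor (Δv μ : ℝ) (n : FermionTorus 2 L) :
    relabel (Orb.mapEquiv diagReflect) (bogoliubovFactor L Δv μ n) =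
      bogoliubovFactor L (-Δv) μ (diagReflect n) := by
  rw [bogoliubovFactor, bogoliubovFactor, relabel_map_add, relabel_map_smul, relabel_map_smul,
    relabel_matrix_one, relabel_diagReflect_pairCreation, cohU_neg_diagReflect, cohV_neg_diagReflect]

variable (L) in
/-- **The diagonal mirror maps the `d`-wave BCS state at `Δv` to the one at `-Δv`**:
`Γ_R |BCS(Δv)⟩ = |BCS(-Δv)⟩` (signed permutation of the occupation basis). [folklore] -/
theorem relabelVec_diagReflect_bcsState (Δv μ : ℝ) :
    relabelVec (Orb.mapEquiv diagReflect) (bcsState L Δv μ) = bcsState L (-Δv) μ := by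
  have h1 : relabel (Orb.mapEquiv (diagReflect (L := L)))
      (1 : Matrix (Finset (Orb (FermionTorus 2 L))) (Finset (Orb (FermionTorus 2 L))) ℂ) = 1 :=
    relabel_matrix_one _
  have hcomp : ((relabel (Orb.mapEquiv (diagReflect (L := L))) : Matrix (Finset (Orb (FermionTorus 2 L)))
      (Finset (Orb (FermionTorus 2 L))) ℂ → Matrix (Finset (Orb (FermionTorus 2 L)))
      (Finset (Orb (FermionTorus 2 L))) ℂ) ∘ bogoliubovFactor L Δv μ) =
      bogoliubovFactor L (-Δv) μ ∘ (diagReflect (L := L)) :=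
    funext fun n => relabel_diagReflect_bogoliubovFactor Δv μ n
  unfold bcsState
  suffices hP : relabel (Orb.mapEquiv diagReflect)
      ((Finset.univ.toList.map (bogoliubovFactor L Δv μ)).prod) =
      (Finset.univ.toList.map (bogoliubovFactor L (-Δv) μ)).prod by
    rw [← relabel_mulVec_relabelVec, relabelVec_vacuum, hP]
  rw [list_prod_map_of_mul _ h1 (relabel_map_mul _), List.map_map, hcomp]
  exact prod_map_comp_equiv_univ diagReflect _ (commute_bogoliubovFactor _ _ _ _)

/-- Amplitude form of the mirror covariance: `⟨R s|BCS(-Δv)⟩ = ε_R(s) ⟨s|BCS(Δv)⟩`. [folklore] -/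
theorem bcsState_neg_gap_apply_finsetCongr (Δv μ : ℝ) (s : Finset (Orb (FermionTorus 2 L))) :
    bcsState L (-Δv) μ ((Orb.mapEquiv diagReflect).finsetCongr s) =
      relabelSign (Orb.mapEquiv diagReflect) s * bcsState L Δv μ s := by
  rw [← relabelVec_diagReflect_bcsState, relabelVec_apply_finsetCongr]

/-! ### `Δv ↦ -Δv` versus the spin-up parity -/

/-- `Δ_k(-Δv) = -Δ_k(Δv)`. [folklore] -/
theorem gapDelta_neg (Δv : ℝ) (m : FermionTorus 2 L) : gapDelta L (-Δv) m = -gapDelta L Δv m := by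
  unfold gapDelta
  ring

/-- `E_k(-Δv) = E_k(Δv)`. [folklore] -/
theorem bogoliubovE_neg (Δv μ : ℝ) (m : FermionTorus 2 L) :
    bogoliubovE L (-Δv) μ m = bogoliubovE L Δv μ m := by
  rw [bogoliubovE, bogoliubovE, gapDelta_neg, neg_sq]

/-- `u_k(-Δv) = u_k(Δv)`. [folklore] -/
theorem cohU_neg (Δv μ : ℝ) (m : FermionTorus 2 L) : cohU L (-Δv) μ m = cohU L Δv μ m := by
  rw [cohU, cohU, bogoliubovE_neg]

/-- Off the zone diagonals the sign of `v_k` flips with `Δv`: `v_k(-Δv) = -v_k(Δv)` if `Δ_k ≠ 0`.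
[folklore] -/
theorem cohV_neg_of_ne {Δv : ℝ} (μ : ℝ) {m : FermionTorus 2 L} (h : gapDelta L Δv m ≠ 0) :
    cohV L (-Δv) μ m = -cohV L Δv μ m := by
  rw [cohV, cohV, bogoliubovE_neg, gapDelta_neg]
  rcases lt_or_gt_of_ne h with hlt | hgt
  · rw [if_pos (neg_nonneg.2 hlt.le), if_neg (not_le.2 hlt)]
    ring
  · rw [if_neg (not_le.2 (neg_neg_of_pos hgt)), if_pos hgt.le]
    ring

/-- On a zone diagonal ABOVE the Fermi level the factor is trivial: `u_k = 1`, `v_k = 0`.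
[folklore] -/
theorem cohU_cohV_of_gapDelta_eq_zero_of_pos {Δv μ : ℝ} {m : FermionTorus 2 L}
    (hΔ : gapDelta L Δv m = 0) (hξ : 0 < bandXi L μ m) : cohU L Δv μ m = 1 ∧ cohV L Δv μ m = 0 := by
  have hE : bogoliubovE L Δv μ m = bandXi L μ m := by
    rw [bogoliubovE, hΔ, zero_pow two_ne_zero, add_zero, Real.sqrt_sq hξ.le]
  rw [cohU, cohV, hE, div_self hξ.ne', hΔ]
  norm_num

/-- On a zone diagonal BELOW the Fermi level the pair is always present: `u_k = 0`, `v_k = 1`.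
[folklore] -/
theorem cohU_cohV_of_gapDelta_eq_zero_of_neg {Δv μ : ℝ} {m : FermionTorus 2 L}
    (hΔ : gapDelta L Δv m = 0) (hξ : bandXi L μ m < 0) : cohU L Δv μ m = 0 ∧ cohV L Δv μ m = 1 := by
  have hE : bogoliubovE L Δv μ m = -bandXi L μ m := by
    rw [bogoliubovE, hΔ, zero_pow two_ne_zero, add_zero, Real.sqrt_sq_eq_abs, abs_of_neg hξ]
  rw [cohU, cohV, hE, div_neg, div_self hξ.ne, hΔ]
  norm_num

/-- `D₋`: the number of zone-diagonal momenta (`Δ_k = 0`) below the Fermi level (`ξ_k < 0`); the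
mirror character of the state is `(-1)^{D₋ + N↑}`. [folklore] -/
def diagBelowCount (L : ℕ) (Δv μ : ℝ) : ℕ :=
  (Finset.univ.filter fun m : FermionTorus 2 L => gapDelta L Δv m = 0 ∧ bandXi L μ m < 0).card

/-- `P b_k P = -b_k`: the pair creator is odd under the spin-up parity. [folklore] -/
theorem upParity_mul_pairCreation_mul_upParity (n : FermionTorus 2 L) :
    upParity * pairCreation L n * upParity = -pairCreation L n := by
  unfold pairCreation
  rw [Finset.mul_sum, Finset.sum_mul, ← Finset.sum_neg_distrib]
  refine Finset.sum_congr rfl fun x _ => ?_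
  rw [Finset.mul_sum, Finset.sum_mul, ← Finset.sum_neg_distrib]
  refine Finset.sum_congr rfl fun y _ => ?_
  rw [Matrix.mul_smul, Matrix.smul_mul, upParity_mul_pair_mul_upParity, smul_neg]

/-- `P (u_k + v_k b_k) P = u_k - v_k b_k = (u_k + v_k b_k) - 2 v_k b_k`. [folklore] -/
theorem upParity_mul_bogoliubovFactor_mul_upParity (Δv μ : ℝ) (m : FermionTorus 2 L) :
    upParity * bogoliubovFactor L Δv μ m * upParity =
      bogoliubovFactor L Δv μ m - (2 * ((cohV L Δv μ m : ℝ) : ℂ)) • pairCreation L m := by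
  rw [bogoliubovFactor, Matrix.mul_add, Matrix.add_mul, Matrix.mul_smul, Matrix.smul_mul,
    Matrix.mul_one, Matrix.mul_smul, Matrix.smul_mul, upParity_mul_pairCreation_mul_upParity,
    ← upParity_mul_self, smul_neg, ← smul_smul, two_smul]
  abel

/-- Under the closed-shell hypothesis `∀ k, Δ_k = 0 → ξ_k ≠ 0`, the factor at `-Δv` is the parity
conjugate of the factor at `Δv`, up to the sign `-1` exactly at the diagonal momenta below the
Fermi level. [folklore] -/
theorem bogoliubovFactor_neg_gap_eq {Δv μ : ℝ}
    (h0 : ∀ m : FermionTorus 2 L, gapDelta L Δv m = 0 → bandXi L μ m ≠ 0) (m : FermionTorus 2 L) :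
    bogoliubovFactor L (-Δv) μ m =
      (if gapDelta L Δv m = 0 ∧ bandXi L μ m < 0 then (-1 : ℂ) else 1) •
        (upParity * bogoliubovFactor L Δv μ m * upParity) := by
  rw [upParity_mul_bogoliubovFactor_mul_upParity]
  by_cases hΔ : gapDelta L Δv m = 0
  · have hΔ' : gapDelta L (-Δv) m = 0 := by rw [gapDelta_neg, hΔ, neg_zero]
    rcases lt_or_gt_of_ne (h0 m hΔ) with hlt | hgt
    · obtain ⟨hu, hv⟩ := cohU_cohV_of_gapDelta_eq_zero_of_neg hΔ hlt
      obtain ⟨hu', hv'⟩ := cohU_cohV_of_gapDelta_eq_zero_of_neg hΔ' hlt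
      rw [if_pos ⟨hΔ, hlt⟩, bogoliubovFactor, bogoliubovFactor, hu, hv, hu', hv']
      simp only [Complex.ofReal_zero, Complex.ofReal_one, zero_smul, one_smul, zero_add, mul_one,
        two_smul, neg_smul]
      abel
    · obtain ⟨hu, hv⟩ := cohU_cohV_of_gapDelta_eq_zero_of_pos hΔ hgt
      obtain ⟨hu', hv'⟩ := cohU_cohV_of_gapDelta_eq_zero_of_pos hΔ' hgt
      rw [if_neg (fun h => (lt_irrefl _ (h.2.trans hgt)).elim), bogoliubovFactor, bogoliubovFactor,
        hu, hv, hu', hv']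
      simp only [Complex.ofReal_zero, Complex.ofReal_one, zero_smul, one_smul, add_zero, mul_zero,
        sub_zero]
  · rw [if_neg (fun h => hΔ h.1), one_smul, bogoliubovFactor, bogoliubovFactor, cohU_neg,
      cohV_neg_of_ne μ hΔ, Complex.ofReal_neg, neg_smul, ← smul_smul, two_smul]
    abel

/-- **`Δv ↦ -Δv` is the spin-up parity up to a sign**: under the closed-shell hypothesis,
`|BCS(-Δv)⟩ = (-1)^{D₋} P |BCS(Δv)⟩`, `P = (-1)^{N↑}`. [folklore] -/
theorem bcsState_neg_gap_eq {Δv μ : ℝ}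
    (h0 : ∀ m : FermionTorus 2 L, gapDelta L Δv m = 0 → bandXi L μ m ≠ 0) :
    bcsState L (-Δv) μ = ((-1 : ℂ) ^ diagBelowCount L Δv μ) • (upParity *ᵥ bcsState L Δv μ) := by
  have hfun : bogoliubovFactor L (-Δv) μ = fun m =>
      (if gapDelta L Δv m = 0 ∧ bandXi L μ m < 0 then (-1 : ℂ) else 1) •
        (upParity * bogoliubovFactor L Δv μ m * upParity) :=
    funext (bogoliubovFactor_neg_gap_eq h0)
  have hc : ((Finset.univ : Finset (FermionTorus 2 L)).toList.map fun m =>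
      if gapDelta L Δv m = 0 ∧ bandXi L μ m < 0 then (-1 : ℂ) else 1).prod =
      (-1) ^ diagBelowCount L Δv μ := by
    rw [Finset.prod_map_toList, Finset.prod_ite, Finset.prod_const_one, mul_one, Finset.prod_const]
    rfl
  unfold bcsState
  rw [hfun, list_prod_map_smul_conj upParity upParity_mul_upParity_mul, hc, smul_mulVec,
    ← mulVec_mulVec, ← mulVec_mulVec, upParity_mulVec_vacuum]

/-- Amplitude form: `⟨s|BCS(-Δv)⟩ = (-1)^{D₋} (-1)^{N↑(s)} ⟨s|BCS(Δv)⟩`. [folklore] -/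
theorem bcsState_neg_gap_apply {Δv μ : ℝ}
    (h0 : ∀ m : FermionTorus 2 L, gapDelta L Δv m = 0 → bandXi L μ m ≠ 0)
    (s : Finset (Orb (FermionTorus 2 L))) :
    bcsState L (-Δv) μ s = (-1) ^ diagBelowCount L Δv μ * ((-1) ^ upCount s * bcsState L Δv μ s) := by
  rw [bcsState_neg_gap_eq h0, Pi.smul_apply, smul_eq_mul, upParity_mulVec_apply]

/-! ### Reflection-forced exact zeros -/

/-- **Mirror covariance of the amplitudes**: `⟨R s|BCS⟩ = (-1)^{D₋ + N↑(s)} ε_R(s) ⟨s|BCS⟩` for every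
configuration `s`, under the closed-shell hypothesis. [folklore] -/
theorem bcsState_apply_finsetCongr_diagReflect {Δv μ : ℝ}
    (h0 : ∀ m : FermionTorus 2 L, gapDelta L Δv m = 0 → bandXi L μ m ≠ 0)
    (s : Finset (Orb (FermionTorus 2 L))) :
    bcsState L Δv μ ((Orb.mapEquiv diagReflect).finsetCongr s) =
      (-1) ^ (diagBelowCount L Δv μ + upCount s) * relabelSign (Orb.mapEquiv diagReflect) s *
        bcsState L Δv μ s := by
  have h1 := bcsState_neg_gap_apply_finsetCongr Δv μ s
  rw [bcsState_neg_gap_apply h0, upCount_finsetCongr_mapEquiv] at h1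
  calc bcsState L Δv μ ((Orb.mapEquiv diagReflect).finsetCongr s)
      = ((-1 : ℂ) ^ diagBelowCount L Δv μ * (-1) ^ diagBelowCount L Δv μ) *
          ((-1) ^ upCount s * (-1) ^ upCount s) *
          bcsState L Δv μ ((Orb.mapEquiv diagReflect).finsetCongr s) := by
        rw [neg_one_pow_mul_neg_one_pow, neg_one_pow_mul_neg_one_pow, one_mul, one_mul]
    _ = (-1) ^ diagBelowCount L Δv μ * (-1) ^ upCount s *
          ((-1) ^ diagBelowCount L Δv μ * ((-1) ^ upCount s *
            bcsState L Δv μ ((Orb.mapEquiv diagReflect).finsetCongr s))) := by ring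
    _ = (-1) ^ (diagBelowCount L Δv μ + upCount s) * relabelSign (Orb.mapEquiv diagReflect) s *
          bcsState L Δv μ s := by rw [h1, pow_add]; ring

/-- **Reflection-forced nodes of the `d`-wave BCS state.** Under the closed-shell hypothesis, a
configuration `s` that is mapped to itself by the diagonal mirror and whose relabelling sign is
not the mirror character, `ε_R(s) ≠ (-1)^{D₋ + N↑(s)}`, has amplitude zero:
`⟨s|BCS⟩ = 0`. [folklore] -/
theorem bcsState_eq_zero_of_diagReflect {Δv μ : ℝ}
    (h0 : ∀ m : FermionTorus 2 L, gapDelta L Δv m = 0 → bandXi L μ m ≠ 0)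
    {s : Finset (Orb (FermionTorus 2 L))} (hs : (Orb.mapEquiv diagReflect).finsetCongr s = s)
    (hsign : relabelSign (Orb.mapEquiv diagReflect) s ≠
      (-1) ^ (diagBelowCount L Δv μ + upCount s)) :
    bcsState L Δv μ s = 0 := by
  have h := bcsState_apply_finsetCongr_diagReflect h0 s
  rw [hs] at h
  have h' : (1 - (-1) ^ (diagBelowCount L Δv μ + upCount s) *
      relabelSign (Orb.mapEquiv diagReflect) s) * bcsState L Δv μ s = 0 := by
    rw [sub_mul, one_mul, ← h, sub_self]
  rcases mul_eq_zero.1 h' with h1 | h1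
  · exfalso
    apply hsign
    have h2 := sub_eq_zero.1 h1
    calc relabelSign (Orb.mapEquiv diagReflect) s
        = ((-1) ^ (diagBelowCount L Δv μ + upCount s) * (-1) ^ (diagBelowCount L Δv μ + upCount s)) *
            relabelSign (Orb.mapEquiv diagReflect) s := by
          rw [neg_one_pow_mul_neg_one_pow, one_mul]
      _ = (-1) ^ (diagBelowCount L Δv μ + upCount s) := by rw [mul_assoc, ← h2, mul_one]
  · exact h1

end ProjectedBCS

/-! ### The real guiding vector and its nodes -/

open ProjectedBCS

/-- The projection weight `[#s = N] g^{D(s)}` is real. [folklore] -/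
theorem conj_projWeight {Λ : Type*} [LinearOrder Λ] [Fintype Λ] (g : ℝ) (N : ℕ) (s : Finset (Orb Λ)) :
    conj (projWeight g N s) = projWeight g N s := by
  unfold projWeight
  split_ifs <;> simp [Complex.conj_ofReal]

/-- **The projected `d`-wave BCS state is real**: `star χ = χ` for
`χ = projectedBCSState g Δv μ L N` (real raw amplitudes, real projection weights, real
normalisation). [folklore] -/
theorem star_projectedBCSState (g Δv μ : ℝ) (L N : ℕ) :
    star (projectedBCSState g Δv μ L N) = projectedBCSState g Δv μ L N := by
  funext s
  rw [Pi.star_apply, projectedBCSState_apply, Complex.star_def, _root_.map_mul, _root_.map_mul,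
    Complex.conj_ofReal, conj_bcsState_apply, conj_projWeight]

/-- The imaginary parts of the amplitudes vanish. [folklore] -/
theorem projectedBCSState_im (g Δv μ : ℝ) (L N : ℕ) (s : Finset (Orb (FermionTorus 2 L))) :
    (projectedBCSState g Δv μ L N s).im = 0 := by
  have h := congrFun (star_projectedBCSState g Δv μ L N) s
  rw [Pi.star_apply, Complex.star_def] at h
  exact Complex.conj_eq_iff_im.1 h

/-- **The real gauge of the projected `d`-wave BCS state**: the real guiding vector
`φ_L(s) = Re ⟨s | projectedBCSState g Δv μ L N⟩` on the occupation basis (the state itself, since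
its amplitudes are real: `ofReal_projectedBCSStateRe`). This is the trial/guiding function
`ψ_T = P_N P_G |BCS⟩` of lattice VMC / fixed-node Monte Carlo, in the gauge in which it is real.
[cite: GubernatisKawashimaWerner2016, §9.2.2 eqs. (9.19)–(9.22)] -/
def projectedBCSStateRe (g Δv μ : ℝ) (L N : ℕ) (s : Finset (Orb (FermionTorus 2 L))) : ℝ :=
  (projectedBCSState g Δv μ L N s).re

/-- `projectedBCSStateRe` unfolded. [folklore] -/
theorem projectedBCSStateRe_def (g Δv μ : ℝ) (L N : ℕ) (s : Finset (Orb (FermionTorus 2 L))) :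
    projectedBCSStateRe g Δv μ L N s = (projectedBCSState g Δv μ L N s).re := rfl

/-- `(φ_L(s) : ℂ) = ⟨s|χ⟩`: the real gauge loses nothing. [folklore] -/
theorem ofReal_projectedBCSStateRe (g Δv μ : ℝ) (L N : ℕ) (s : Finset (Orb (FermionTorus 2 L))) :
    ((projectedBCSStateRe g Δv μ L N s : ℝ) : ℂ) = projectedBCSState g Δv μ L N s :=
  Complex.ext (by simp [projectedBCSStateRe]) (by simp [projectedBCSState_im])

/-- `χ = ofReal ∘ φ_L` as vectors. [folklore] -/
theorem projectedBCSState_eq_ofReal (g Δv μ : ℝ) (L N : ℕ) :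
    projectedBCSState g Δv μ L N = fun s => ((projectedBCSStateRe g Δv μ L N s : ℝ) : ℂ) :=
  funext fun s => (ofReal_projectedBCSStateRe g Δv μ L N s).symm

/-- The real guiding vector vanishes off the `N`-particle sector. [folklore] -/
theorem projectedBCSStateRe_eq_zero_of_card_ne {g Δv μ : ℝ} {L N : ℕ}
    {s : Finset (Orb (FermionTorus 2 L))} (hs : s.card ≠ N) : projectedBCSStateRe g Δv μ L N s = 0 := by
  rw [projectedBCSStateRe, isNParticle_projectedBCSState g Δv μ L N s hs, Complex.zero_re]

/-- The real guiding vector vanishes on spin-unbalanced configurations (`N↑ ≠ N↓`). [folklore] -/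
theorem projectedBCSStateRe_eq_zero_of_upCount_ne {g Δv μ : ℝ} {L N : ℕ}
    {s : Finset (Orb (FermionTorus 2 L))} (hs : upCount s ≠ NagaokaTasaki.downCount s) :
    projectedBCSStateRe g Δv μ L N s = 0 := by
  rw [projectedBCSStateRe, (mem_spinBalanced_iff _).1 (projectedBCSState_mem_spinBalanced g Δv μ L N) s hs,
    Complex.zero_re]

/-- **Support inside the `(N, S^z = 0)` class.** Off the configuration class
`#s = N ∧ 2 · #{o ∈ s | spin o = ↑} = N` quantified over in the fixed-node route items, the real
guiding vector vanishes. [folklore] -/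
theorem projectedBCSStateRe_eq_zero_of_not_mem_class {g Δv μ : ℝ} {L N : ℕ}
    {s : Finset (Orb (FermionTorus 2 L))}
    (hs : ¬ (s.card = N ∧ 2 * (s.filter fun o => (ofLex o).2 = 0).card = N)) :
    projectedBCSStateRe g Δv μ L N s = 0 := by
  by_cases h1 : s.card = N
  · apply projectedBCSStateRe_eq_zero_of_upCount_ne
    intro h2
    apply hs
    refine ⟨h1, ?_⟩
    rw [card_filter_spin_zero_eq_upCount]
    have h3 := card_eq_upCount_add_downCount s
    omega
  · exact projectedBCSStateRe_eq_zero_of_card_ne h1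

/-- **Normalisation of the real guiding vector**: `Σ_s φ_L(s)² = 1` whenever the raw vector
`P_g P_N |BCS⟩` is nonzero. [folklore] -/
theorem sum_projectedBCSStateRe_sq {g Δv μ : ℝ} {L N : ℕ}
    (h : (fun s => projWeight g N s * ProjectedBCS.bcsState L Δv μ s) ≠ 0) :
    ∑ s, projectedBCSStateRe g Δv μ L N s ^ 2 = 1 := by
  have h1 := star_projectedBCSState_dotProduct h
  rw [star_dotProduct_self_eq_sum_normSq, ← Complex.ofReal_one, Complex.ofReal_inj] at h1
  rw [← h1]
  refine Finset.sum_congr rfl fun s _ => ?_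
  rw [Complex.normSq_apply, projectedBCSState_im, mul_zero, add_zero, projectedBCSStateRe, sq]

/-- **Reflection-forced exact zeros of the projected state.** Under the closed-shell hypothesis
on the zone diagonals, every configuration fixed by the diagonal mirror `(x₀,x₁) ↦ (x₁,x₀)` whose
relabelling sign is not the mirror character `(-1)^{D₋ + N↑(s)}` is a node of
`projectedBCSState g Δv μ L N`, for every `g` and `N`. [folklore] -/
theorem projectedBCSState_eq_zero_of_diagReflect {g Δv μ : ℝ} {L N : ℕ}
    (h0 : ∀ m : FermionTorus 2 L, gapDelta L Δv m = 0 → bandXi L μ m ≠ 0)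
    {s : Finset (Orb (FermionTorus 2 L))}
    (hs : (Orb.mapEquiv diagReflect).finsetCongr s = s)
    (hsign : relabelSign (Orb.mapEquiv diagReflect) s ≠ (-1) ^ (diagBelowCount L Δv μ + upCount s)) :
    projectedBCSState g Δv μ L N s = 0 := by
  rw [projectedBCSState_apply, bcsState_eq_zero_of_diagReflect h0 hs hsign, mul_zero, mul_zero]

/-- The same nodes for the real guiding vector; on the `(N, S^z = 0)` class the character is
`(-1)^{D₋ + N/2}` (`upCount_eq_half_of_mem_class`). [folklore] -/
theorem projectedBCSStateRe_eq_zero_of_diagReflect {g Δv μ : ℝ} {L N : ℕ}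
    (h0 : ∀ m : FermionTorus 2 L, gapDelta L Δv m = 0 → bandXi L μ m ≠ 0)
    {s : Finset (Orb (FermionTorus 2 L))}
    (hs : (Orb.mapEquiv diagReflect).finsetCongr s = s)
    (hsign : relabelSign (Orb.mapEquiv diagReflect) s ≠ (-1) ^ (diagBelowCount L Δv μ + upCount s)) :
    projectedBCSStateRe g Δv μ L N s = 0 := by
  rw [projectedBCSStateRe, projectedBCSState_eq_zero_of_diagReflect h0 hs hsign, Complex.zero_re]

end Literature.MathematicalPhysics.QuantumLattice
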